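import Summits.RiemannHypothesis.RiemannHypothesis.Theses.UniversalFactor
import Literature.NumberTheory.LFunctions.DeBruijnHDiv
import Literature.NumberTheory.LFunctions.ZetaZeros
import Summits.RiemannHypothesis.RiemannHypothesis.Theorems.UniversalFactorLaguerreLift

/-!
# Sketch (crux-ideate round 1, ideator 3) — `NarrowKernelNoGo` (stmt-RiemannHypothesis-2576)

Idea card `resonant-window-deviation-lifting`: at the RESONANT heights `ω(x) = ¼ log(x/4π) ≍ r·a`
(`r ∈ [1.3, 2.5]`, Laplace width `√2/a` ≍ mean `x`-spacing `s = π/ω`), every window of `h ≈ 2`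
mean spacings carrying a LARGE DEVIATION of the zero count (a void `ΔN = 0`, or a cluster
`ΔN ≥ 2h`) with `B`-regular flanks forces a lifted dip of `F_a = E[H_0(·+X)]`, i.e. a real point
with `L₁ := F_a'² − a²F_a² + a²F_aH_0 < 0` (Laguerre–Riccati defect, card `laguerre-riccati-defect`),
hence a non-real zero. Such windows have positive measure in every `[T,2T]` by Fujii's Gaussian
moments of `S(t+h) − S(t)` (Paley–Zygmund) — no zero is located by asymptotics of `F_a`.
Only the SIGNATURES below are claimed to elaborate; `narrow_of_lifting` is the checked composition.
-/

noncomputable section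

open Complex MeasureTheory Set

namespace Summit.RiemannHypothesis.RiemannHypothesis.Cruxes.NarrowKernelNoGo.SketchIdeator3

open Literature.NumberTheory.LFunctions
open Summit.RiemannHypothesis.RiemannHypothesis.Theses.UniversalFactor

/-- `F_a = deBruijnHDiv (1 + u²/a²)` (the crux's inlined integral, by `rfl`). [folklore] -/
abbrev F (a : ℝ) : ℂ → ℂ := deBruijnHDiv fun u : ℝ => 1 + u ^ 2 / a ^ 2

/-- The Laguerre–Riccati defect `L₁(x) = F_a'(x)² − a²F_a(x)² + a²F_a(x)H_0(x)` on the real axis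
(`F_a'' = a²(F_a − H_0)` substituted into `F'² − FF''`). [folklore] -/
def L1 (a x : ℝ) : ℝ :=
  (deriv (F a) x).re ^ 2 - a ^ 2 * (F a x).re ^ 2 + a ^ 2 * (F a x).re * (deBruijnH 0 x).re

/-- Local `x`-frequency of `H_0` at `x > 0`: `ω(x) = ¼ log(x/4π)`; mean spacing of its real zeros
is `π/ω(x)` (Riemann–von Mangoldt in the `z = 2t` variable). [folklore] -/
def omegaAt (x : ℝ) : ℝ := Real.log (x / (4 * Real.pi)) / 4

/-- Mean `x`-spacing `s(x) = π/ω(x)`. [folklore] -/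
def spacingAt (x : ℝ) : ℝ := Real.pi / omegaAt x

/-- Zero count of `H_0` in the real window `(x, x + ℓ]` (zeros of `H_0` are `z = 2γ`): `N((x+ℓ)/2) − N(x/2)`. [folklore] -/
def windowCount (x ℓ : ℝ) : ℕ := zetaZeroCount ((x + ℓ) / 2) - zetaZeroCount (x / 2)

/-- VOID-OR-CLUSTER window: `(x, x + h·s]` carries no zero, or at least `2h` zeros. [folklore] -/
def VoidOrCluster (x h : ℝ) : Prop :=
  windowCount x (h * spacingAt x) = 0 ∨ 2 * h ≤ (windowCount x (h * spacingAt x) : ℝ)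

/-- CLOSE PAIR in the window: two consecutive ordinates `γ_n < γ_{n+1}` with `2γ_n, 2γ_{n+1} ∈ (x, x + h·s]`
and `x`-gap `2(γ_{n+1} − γ_n) ≤ μ·s` (`μ·s` = `μ` mean spacings; positive proportion of such `n` with
`μ = 0.77` under RH: Conrey–Ghosh–Goldston–Gonek–Heath-Brown 1985). [folklore] -/
def ClosePairIn (x h μ : ℝ) : Prop :=
  ∃ n : ℕ, x < 2 * zetaOrdinate n ∧ 2 * zetaOrdinate (n + 1) ≤ x + h * spacingAt x ∧
    2 * (zetaOrdinate (n + 1) - zetaOrdinate n) ≤ μ * spacingAt x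

/-- IRREGULAR window at the Laplace scale: void, cluster, or close pair. [folklore] -/
def Irregular (x h μ : ℝ) : Prop := VoidOrCluster x h ∨ ClosePairIn x h μ

/-- `B`-REGULAR FLANKS out to `±K` spacings: every sub-window of one mean spacing inside
`[x − K s, x + K s]` carries between `0` and `1 + B` zeros... stated as `|count − 1| ≤ B`. [folklore] -/
def FlankRegular (x K B : ℝ) : Prop :=
  ∀ y : ℝ, x - K * spacingAt x ≤ y → y + spacingAt x ≤ x + K * spacingAt x →
    |(windowCount y (spacingAt x) : ℝ) - 1| ≤ B

/-- **FIRST LEMMA of the line (deterministic lifting lemma, signature only).** For `a ≥ A₀`, at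
resonant heights `r₁ a ≤ ω(x) ≤ r₂ a` (intended `r ≈ 2.5–3.5`), if `H_0` has only real zeros (free on
this crux), an irregular window (void / cluster / close pair `≤ μ s`) with `B`-regular flanks forces
`L₁ < 0` at some real point within two spacings of the window. Finite-dimensional (compact configuration space) — certifiable by interval
arithmetic plus a modulus of continuity; model numerics: Ideas card, table (folder calc/cosmodel.py). [folklore] -/
def LiftingLemma (r₁ r₂ h μ K B A₀ : ℝ) : Prop :=
  ∀ a : ℝ, A₀ ≤ a → HasOnlyRealZeros (deBruijnH 0) →
    ∀ x : ℝ, 0 < x → r₁ * a ≤ omegaAt x → omegaAt x ≤ r₂ * a →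
      Irregular x h μ → FlankRegular x K B →
        ∃ x' : ℝ, x - 2 * spacingAt x ≤ x' ∧ x' ≤ x + (h + 2) * spacingAt x ∧ L1 a x' < 0

/-- **ARITHMETIC INPUT (signature only).** In every resonant height range there is an irregular
window with regular flanks: a POSITIVE PROPORTION of close pairs (`μ = 0.77`, RH — free here) by
Conrey–Ghosh–Goldston–Gonek–Heath-Brown 1985 (Soundararajan 1996: `0.6878`), minus the
`o(1)`-proportion of zeros whose `±K s` flanks are `B`-irregular (Fujii's second moment of
`S(t+h) − S(t)`, in tree as `meanSquare_block_of_approxFormula`, + Cauchy–Schwarz). [cite: CGGGHB1985; Fujii1975] -/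
def IrregularWindows (r₁ r₂ h μ K B A₀ : ℝ) : Prop :=
  ∀ a : ℝ, A₀ ≤ a → ∃ x : ℝ, 0 < x ∧ r₁ * a ≤ omegaAt x ∧ omegaAt x ≤ r₂ * a ∧
    Irregular x h μ ∧ FlankRegular x K B

/-- Card `laguerre-riccati-defect`'s first lemma (LP ⇒ `L₁ ≥ 0` on ℝ), restated. [folklore] -/
def LaguerreCertificate : Prop :=
  ∀ a : ℝ, 0 < a → HasOnlyRealZeros (F a) → ∀ x : ℝ, 0 ≤ L1 a x

/-- **Checked composition.** Certificate + lifting lemma + deviation windows ⇒ the crux, for any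
admissible parameters with `A₀ ≤ 32`; RH enters for free through the PROVED `laguerreLift`. -/
theorem narrow_of_lifting {r₁ r₂ h μ K B A₀ : ℝ} (hA₀ : A₀ ≤ 32)
    (hC : LaguerreCertificate) (hL : LiftingLemma r₁ r₂ h μ K B A₀)
    (hD : IrregularWindows r₁ r₂ h μ K B A₀) : NarrowKernelNoGo := by
  intro a ha hF
  have ha0 : 0 < a := by linarith
  have hH : HasOnlyRealZeros (deBruijnH 0) :=
    Theorems.UniversalFactor.laguerreLift a ha0 hF
  obtain ⟨x, hx, h1, h2, hV, hR⟩ := hD a (le_trans hA₀ ha)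
  obtain ⟨x', -, -, hneg⟩ := hL a (le_trans hA₀ ha) hH x hx h1 h2 hV hR
  have hpos : 0 ≤ L1 a x' := hC a ha0 hF x'
  linarith

end Summit.RiemannHypothesis.RiemannHypothesis.Cruxes.NarrowKernelNoGo.SketchIdeator3
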